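import Summits.NavierStokesRegularity.NavierStokesRegularity.Theorems.SkeletonEquilibrium.Negative.StrainIdentity

/-!
# `SkeletonEquilibrium` (stmt-NavierStokesRegularity-15400): planar skeletons drift at the Leray rate

Negative-side support for the crux `FilamentSkeletonRss.SkeletonEquilibrium`, from the cdisprove work
file `Cruxes/SkeletonEquilibrium/Disproof.lean` §(c3)/(e1) (seat
refuter-cdisprove-stmt-NavierStokesRegularity-15400-0, 2026-08-16); companion of the landed
`StrainIdentity` (every witness has `w_j′ = ½ + axial Biot–Savart strain`) and `StraightLinesVertical`
(straight skeletons are vertical, slope `½`). The natural strengthening "the skeleton may be taken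
PLANAR (all filaments in the horizontal plane through the origin, the plane fixed by the frame
rotation)" is refuted at every supercritical threshold:

* `planar_slope_half` — if every filament lies in `{z = 0}` and the per-filament clauses and the
  relative-equilibrium system of the crux hold (any `N, γ, α, Γ`), then `w_j′ ≡ ½`. Mechanism: tangents
  of planar curves are horizontal, and the Rosenhead–Biot–Savart integrand `Ξ_k′σ × (Ξ_jτ − Ξ_kσ)` of a
  horizontal tangent against a horizontal chord is VERTICAL; so the skeleton's induced velocity along
  each filament is vertical (componentwise through the Bochner integral, convergent or not), its
  derivative is vertical, and its axial component against the horizontal tangent — the axial strain of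
  the strain identity — vanishes.
* `planar_not_supercritical` — hence no clause `c + δ ≤ w_j′(τ*)` with `c ≥ ½`, `δ > 0` (crux: `3/2`).
With the straight and axis-parallel classes this exhausts the rigid/degenerate configuration classes:
a witness of the crux is a genuinely three-dimensional curved configuration whose supercritical margin
is mutual axial strain at the waist.
-/

set_option linter.dupNamespace false

namespace Summit.NavierStokesRegularity.NavierStokesRegularity.Theorems.SkeletonEquilibrium.Negative

open Literature.Analysis.FluidPDE MeasureTheory
open scoped RealInnerProductSpace InnerProductSpace BigOperators

/-- Horizontal × horizontal is vertical: the `e₀`- and `e₁`-components of `u × v` vanish when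
`u₂ = v₂ = 0`. [folklore] -/
private theorem inner_cross_single_of_horizontal {u v : EuclideanSpace ℝ (Fin 3)} (hu : u 2 = 0)
    (hv : v 2 = 0) :
    ⟪cross u v, EuclideanSpace.single (0 : Fin 3) (1 : ℝ)⟫ = 0 ∧
      ⟪cross u v, EuclideanSpace.single (1 : Fin 3) (1 : ℝ)⟫ = 0 := by
  constructor <;> simp [cross, cross_apply, EuclideanSpace.inner_single_right, hu, hv]

/-- A coordinate of the derivative is the derivative of the coordinate. [folklore] -/
private theorem deriv_coord {F : ℝ → EuclideanSpace ℝ (Fin 3)} {τ : ℝ} (hF : DifferentiableAt ℝ F τ)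
    (i : Fin 3) : deriv (fun σ => F σ i) τ = deriv F τ i :=
  ((EuclideanSpace.proj (𝕜 := ℝ) i).hasFDerivAt.comp_hasDerivAt τ hF.hasDerivAt).deriv

/-- An identically vanishing coordinate has vanishing derivative coordinate. [folklore] -/
private theorem deriv_coord_eq_zero {F : ℝ → EuclideanSpace ℝ (Fin 3)} (hF : Differentiable ℝ F)
    {i : Fin 3} (h : ∀ σ, F σ i = 0) (τ : ℝ) : deriv F τ i = 0 := by
  rw [← deriv_coord (hF τ) i, show (fun σ => F σ i) = fun _ => (0 : ℝ) from funext h, deriv_const]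

/-- If `⟪F σ, c⟫ = 0` identically for a differentiable `F`, then `⟪F′ τ, c⟫ = 0`. [folklore] -/
private theorem inner_deriv_eq_zero {F : ℝ → EuclideanSpace ℝ (Fin 3)} (hF : Differentiable ℝ F)
    {c : EuclideanSpace ℝ (Fin 3)} (h : ∀ σ, ⟪F σ, c⟫ = 0) (τ : ℝ) : ⟪deriv F τ, c⟫ = 0 := by
  have h1 : HasDerivAt (fun σ => ⟪F σ, c⟫) (⟪F τ, (0 : EuclideanSpace ℝ (Fin 3))⟫ + ⟪deriv F τ, c⟫) τ :=
    (hF τ).hasDerivAt.inner ℝ (hasDerivAt_const τ c)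
  rw [show (fun σ => ⟪F σ, c⟫) = fun _ => (0 : ℝ) from funext h] at h1
  have h2 := h1.unique (hasDerivAt_const τ (0 : ℝ))
  rw [inner_zero_right, zero_add] at h2
  exact h2

/-- **Planar skeletons drift at exactly the Leray rate.** If every filament lies in the horizontal
plane `{z = 0}` and the per-filament clauses (C², unit speed, `w_j` differentiable) and the
relative-equilibrium system of `SkeletonEquilibrium` hold (any `N, γ, α, Γ`), then `w_j′(τ) = ½` for
all `j, τ`. [folklore] -/
theorem planar_slope_half {N : ℕ} (γ : Fin N → ℝ) (α Γ : ℝ)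
    (Ξ : Fin N → ℝ → EuclideanSpace ℝ (Fin 3)) (hplane : ∀ k τ, Ξ k τ 2 = 0)
    (hC2 : ∀ j, ContDiff ℝ 2 (Ξ j)) (hunit : ∀ j τ, ‖deriv (Ξ j) τ‖ = 1)
    (w : Fin N → ℝ → ℝ) (hw : ∀ j, Differentiable ℝ (w j))
    (heq : ∀ j τ, (∑ k : Fin N, (Γ * γ k / (4 * Real.pi)) • ∫ σ : ℝ,
      ((‖Ξ j τ - Ξ k σ‖ ^ 2 + 1) ^ (3 / 2 : ℝ))⁻¹ • cross (deriv (Ξ k) σ) (Ξ j τ - Ξ k σ)) +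
      (1 / 2 : ℝ) • Ξ j τ - α • cross (EuclideanSpace.single (2 : Fin 3) (1 : ℝ)) (Ξ j τ) =
      w j τ • deriv (Ξ j) τ)
    (j : Fin N) (τ : ℝ) : deriv (w j) τ = 1 / 2 := by
  obtain ⟨hFd, hslope⟩ := witness_slope_eq hC2 hunit hw heq j
  set F : ℝ → EuclideanSpace ℝ (Fin 3) := fun τ => ∑ k : Fin N, (Γ * γ k / (4 * Real.pi)) •
    ∫ σ : ℝ, ((‖Ξ j τ - Ξ k σ‖ ^ 2 + 1) ^ (3 / 2 : ℝ))⁻¹ • cross (deriv (Ξ k) σ) (Ξ j τ - Ξ k σ)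
    with hFdef
  -- tangents are horizontal
  have hT : ∀ k σ, deriv (Ξ k) σ 2 = 0 := fun k σ =>
    deriv_coord_eq_zero ((hC2 k).differentiable (by norm_num)) (hplane k) σ
  -- chords are horizontal
  have hchord : ∀ k σ σ', (Ξ j σ' - Ξ k σ) 2 = 0 := by
    intro k σ σ'
    rw [PiLp.sub_apply, hplane j, hplane k, sub_zero]
  -- the induced velocity along the filament is vertical
  have hF01 : ∀ σ', ⟪F σ', EuclideanSpace.single (0 : Fin 3) (1 : ℝ)⟫ = 0 ∧
      ⟪F σ', EuclideanSpace.single (1 : Fin 3) (1 : ℝ)⟫ = 0 := by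
    intro σ'
    have hint : ∀ (k : Fin N) (i : Fin 3), (i = 0 ∨ i = 1) →
        ⟪(∫ σ : ℝ, ((‖Ξ j σ' - Ξ k σ‖ ^ 2 + 1) ^ (3 / 2 : ℝ))⁻¹ •
          cross (deriv (Ξ k) σ) (Ξ j σ' - Ξ k σ)), EuclideanSpace.single i (1 : ℝ)⟫ = 0 := by
      intro k i hi
      by_cases hI : Integrable (fun σ : ℝ => ((‖Ξ j σ' - Ξ k σ‖ ^ 2 + 1) ^ (3 / 2 : ℝ))⁻¹ •
          cross (deriv (Ξ k) σ) (Ξ j σ' - Ξ k σ))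
      · rw [real_inner_comm, ← integral_inner hI]
        refine integral_eq_zero_of_ae (Filter.Eventually.of_forall fun σ => ?_)
        show ⟪EuclideanSpace.single i (1 : ℝ), _⟫ = (0 : ℝ)
        rw [real_inner_smul_right, real_inner_comm]
        rcases hi with rfl | rfl
        · rw [(inner_cross_single_of_horizontal (hT k σ) (hchord k σ σ')).1, mul_zero]
        · rw [(inner_cross_single_of_horizontal (hT k σ) (hchord k σ σ')).2, mul_zero]
      · rw [integral_undef hI, inner_zero_left]
    simp only [hFdef, sum_inner, real_inner_smul_left]
    exact ⟨Finset.sum_eq_zero fun k _ => by rw [hint k 0 (Or.inl rfl), mul_zero],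
      Finset.sum_eq_zero fun k _ => by rw [hint k 1 (Or.inr rfl), mul_zero]⟩
  -- hence so is its derivative
  have hdF0 : ⟪deriv F τ, EuclideanSpace.single (0 : Fin 3) (1 : ℝ)⟫ = 0 :=
    inner_deriv_eq_zero hFd (fun σ => (hF01 σ).1) τ
  have hdF1 : ⟪deriv F τ, EuclideanSpace.single (1 : Fin 3) (1 : ℝ)⟫ = 0 :=
    inner_deriv_eq_zero hFd (fun σ => (hF01 σ).2) τ
  have hc0 : deriv F τ 0 = 0 := by simpa [EuclideanSpace.inner_single_right] using hdF0
  have hc1 : deriv F τ 1 = 0 := by simpa [EuclideanSpace.inner_single_right] using hdF1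
  -- the axial strain vanishes: ⟪F′, Ξ_j′⟫ = F′₀T₀ + F′₁T₁ + F′₂T₂ with F′₀ = F′₁ = T₂ = 0
  have hinner : ⟪deriv F τ, deriv (Ξ j) τ⟫ = 0 := by
    simp only [PiLp.inner_apply, RCLike.inner_apply, conj_trivial, Fin.sum_univ_three]
    rw [show (deriv F τ).ofLp 0 = deriv F τ 0 from rfl, show (deriv F τ).ofLp 1 = deriv F τ 1 from rfl,
      show (deriv (Ξ j) τ).ofLp 2 = deriv (Ξ j) τ 2 from rfl, hc0, hc1, hT j τ]
    ring
  rw [hslope τ, hinner, add_zero]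

/-- Hence a planar skeleton never meets a supercritical clause `c + δ ≤ w_j′(τ*)` with `c ≥ ½`,
`δ > 0` (the crux: `c = 3/2`). [folklore] -/
theorem planar_not_supercritical {N : ℕ} (γ : Fin N → ℝ) (α Γ : ℝ) {c δ : ℝ} (hc : 1 / 2 ≤ c)
    (hδ : 0 < δ)
    (Ξ : Fin N → ℝ → EuclideanSpace ℝ (Fin 3)) (hplane : ∀ k τ, Ξ k τ 2 = 0)
    (hC2 : ∀ j, ContDiff ℝ 2 (Ξ j)) (hunit : ∀ j τ, ‖deriv (Ξ j) τ‖ = 1)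
    (w : Fin N → ℝ → ℝ) (hw : ∀ j, Differentiable ℝ (w j))
    (heq : ∀ j τ, (∑ k : Fin N, (Γ * γ k / (4 * Real.pi)) • ∫ σ : ℝ,
      ((‖Ξ j τ - Ξ k σ‖ ^ 2 + 1) ^ (3 / 2 : ℝ))⁻¹ • cross (deriv (Ξ k) σ) (Ξ j τ - Ξ k σ)) +
      (1 / 2 : ℝ) • Ξ j τ - α • cross (EuclideanSpace.single (2 : Fin 3) (1 : ℝ)) (Ξ j τ) =
      w j τ • deriv (Ξ j) τ)
    (j : Fin N) (τs : ℝ) : ¬ (c + δ ≤ deriv (w j) τs) := by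
  rw [planar_slope_half γ α Γ Ξ hplane hC2 hunit w hw heq j τs]
  linarith

end Summit.NavierStokesRegularity.NavierStokesRegularity.Theorems.SkeletonEquilibrium.Negative
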